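import Literature.AlgebraicGeometry.Resolution.PointBlowupOrderChart
import Literature.AlgebraicGeometry.Resolution.BlowupStalkCharts
import Literature.AlgebraicGeometry.Resolution.HypersurfaceTransform
import Literature.AlgebraicGeometry.Resolution.RegularSystemOfParameters
import Mathlib.Algebra.Group.Units.Equiv
import HarnessLib

/-!
# The order of the weak transform under the blowing up of a point (Cossart–Piltant 2008, Prop. 4.2 (a))

Topic: `Literature/AlgebraicGeometry/Resolution`. The scheme-level form of Hironaka's
fundamental inequality for the blowing up of a closed point, [CoP1] = Cossart–Piltant,
J. Algebra 320 (2008), proof of Prop. 4.2, p. 8: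

> "Let `E′` be the transform of `E` in the blowing up `X′` of `(X, x)` along `Y`, i.e.
> `E′ = (J′, μ)` where `J′ = I(Y)^{-μ} J` is the weak transform of `J`. … (a) For any point `x′`
> above `x`, `ord_{x′} J′ ≤ μ`."

for the centre `Y = {x}` (the case `r = 3` of loc. cit.; Hironaka 1964, Ch. III), PROVED over
the tree for blowing ups in the sense of the universal property (`IsBlowup`, `Blowups.lean`) and
the weak (= controlled) transform `J′ = (π^*J : 𝓘(E)^μ)` of `MarkedIdeals.lean`
(`controlledTransform π C J μ`):

**Theorem** (`IsBlowup.not_stalkIdeal_controlledTransform_le_pow`,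
`IsBlowup.idealOrder_controlledTransform_le`). Let `π : X′ → X` be a blowing up along an
ideal sheaf `C` whose stalk at `x = π(x′)` is the maximal ideal of the REGULAR local ring
`𝒪_{X,x}` (e.g. `C` the ideal of the closed point `x` of a regular scheme), `X′` locally
Noetherian, and `J` an ideal sheaf of order exactly `μ` at `x` (`J_x ⊆ 𝔪_x^μ`,
`J_x ⊄ 𝔪_x^{μ+1}`). Then `J′_{x′} ⊄ 𝔪_{x′}^{μ+1}`, i.e. `ord_{x′} J′ ≤ μ`.

Proof: the local ring `𝒪_{X′,x′}` is a localisation `(B_j)_𝔴` of a chart ring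
`B_j = (𝒪_{X,x}[𝔪t])_{(c_j t)}` of `Bl_𝔪(Spec 𝒪_{X,x})` for a regular system of parameters `c`,
at a prime `𝔴` over `𝔪` (`IsBlowup.exists_reesChart_stalk`, `BlowupStalkCharts.lean`); for
`f ∈ J_x` of order `μ` the chart form (`exists_weakTransform_chart_not_mem_pow`,
`PointBlowupOrderChart.lean`) gives `f = c_j^μ f′` with `ord_𝔴 f′ ≤ μ`, and `f′ ∈ J′_{x′}`
because `𝓘(E)_{x′} = (c_j)` and `π^*J_{x′} = J_x 𝒪_{X′,x′}` (`stalkIdeal_colon`,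
`stalkIdeal_comap_eq_map_stalkMap`).

## Sources

* V. Cossart, O. Piltant, J. Algebra 320 (2008) 1051–1082, proof of Prop. 4.2, (a), p. 8.
  [CossartPiltant2008]
* H. Hironaka, Ann. of Math. 79 (1964) — background (the invariant `ν` under permissible
  blowing ups).
-/

noncomputable section

open CategoryTheory CategoryTheory.Limits AlgebraicGeometry TopologicalSpace IsLocalRing

namespace Literature.AlgebraicGeometry.Resolution

universe u

variable {X X' : Scheme.{u}} {π : X' ⟶ X} {C J : X.IdealSheafData}

/-- Along a sequence generating `𝔪`, the image of `𝔪` in a ring where all generators become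
multiples of one of them is principal: if `ψ(c_l) = ψ(c_j) · u_l` for all `l` then
`𝔪 · (target) = (ψ c_j)`. [folklore] -/
theorem Ideal.map_span_range_eq_span_singleton {R A : Type*} [CommRing R] [CommRing A]
    (ψ : R →+* A) {d : ℕ} (c : Fin d → R) (j : Fin d) (u : Fin d → A)
    (hu : ∀ l, ψ (c l) = ψ (c j) * u l) :
    (Ideal.span (Set.range c)).map ψ = Ideal.span {ψ (c j)} := by
  apply le_antisymm
  · rw [Ideal.map_span, Ideal.span_le]
    rintro _ ⟨_, ⟨l, rfl⟩, rfl⟩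
    rw [SetLike.mem_coe, hu l]
    exact Ideal.mul_mem_right _ _ (Ideal.mem_span_singleton_self _)
  · rw [Ideal.span_singleton_le_iff_mem]
    exact Ideal.mem_map_of_mem ψ (Ideal.subset_span ⟨j, rfl⟩)

/-- The colon-ideal bookkeeping behind `f′ ∈ J′_{x′}` (pure ring theory): if `χ ∘ φ = ψ`,
`φ(f) = t^μ f′` and `f ∈ J`, then `χ(f′) · (χ t)^μ S ⊆ ψ(J) S`, i.e.
`χ f′ ∈ (ψ(J) S : (χ t)^μ)`. [folklore] -/
theorem map_mem_colon_of_eq_pow_mul {R B S : Type*} [CommRing R] [CommRing B] [CommRing S]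
    (φ : R →+* B) (χ : B →+* S) (ψ : R →+* S) (hχ : ∀ a, χ (φ a) = ψ a) {t f' : B} {f : R}
    {μ : ℕ} (hff' : φ f = t ^ μ * f') {Jx : Ideal R} (hfJ : f ∈ Jx) :
    χ f' ∈ Submodule.colon (Jx.map ψ) ((Ideal.span {χ t} ^ μ : Ideal S) : Set S) := by
  rw [Submodule.mem_colon]
  intro s hs
  rw [Ideal.span_singleton_pow, SetLike.mem_coe] at hs
  obtain ⟨r, rfl⟩ := Ideal.mem_span_singleton'.mp hs
  have : χ f' * (r * χ t ^ μ) = r * ψ f := by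
    rw [← hχ f, hff', map_mul, map_pow]
    ring
  rw [smul_eq_mul, this]
  exact Ideal.mul_mem_left _ r (Ideal.mem_map_of_mem _ hfJ)

/-- Transport of "order `≤ n`" from the standard localisation `B_𝔴` to any localisation `S` of
`B` at `𝔴` (pure ring theory). [folklore] -/
theorem algebraMap_not_mem_maximalIdeal_pow_of_isLocalization {B S : Type*} [CommRing B]
    [CommRing S] [Algebra B S] (𝔴 : Ideal B) [𝔴.IsPrime] [IsLocalization.AtPrime S 𝔴]
    [IsLocalRing S] {b : B} {n : ℕ}
    (h : algebraMap B (Localization.AtPrime 𝔴) b ∉ maximalIdeal (Localization.AtPrime 𝔴) ^ n) :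
    algebraMap B S b ∉ maximalIdeal S ^ n := by
  intro hmem
  apply h
  let e := IsLocalization.algEquiv 𝔴.primeCompl (Localization.AtPrime 𝔴) S
  have h1 : e.symm (algebraMap B S b) = algebraMap B (Localization.AtPrime 𝔴) b := by
    rw [← e.commutes b, AlgEquiv.symm_apply_apply]
  rw [← h1]
  haveI : IsLocalHom e.symm.toRingEquiv.toRingHom :=
    ⟨fun a ha => (MulEquiv.isUnit_map e.symm.toRingEquiv (x := a)).mp ha⟩
  exact Ideal.map_maximalIdeal_pow_le e.symm.toRingEquiv.toRingHom n
    (Ideal.mem_map_of_mem e.symm.toRingEquiv.toRingHom hmem)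

/-- **[CoP1] Prop. 4.2, proof, (a): `ord_{x′} J′ ≤ μ` — the weak transform under the blowing up
of a point of a regular scheme does not increase the order.** For a blowing up `π : X′ → X`
along `C` with `C_{π x′} = 𝔪_{π x′}`, `𝒪_{X,π x′}` regular, and `J_{π x′} ⊆ 𝔪^μ`,
`J_{π x′} ⊄ 𝔪^{μ+1}`: the stalk at `x′` of the weak transform `J′ = (π^*J : 𝓘(E)^μ)` is not
contained in `𝔪_{x′}^{μ+1}`. [cite: CossartPiltant2008, proof of Prop. 4.2 (a)] -/
theorem IsBlowup.not_stalkIdeal_controlledTransform_le_pow [IsLocallyNoetherian X']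
    (hπ : IsBlowup π C) (x' : X') [IsRegularLocalRing (X.presheaf.stalk (π x'))]
    (hC : stalkIdeal C (π x') = maximalIdeal (X.presheaf.stalk (π x'))) {μ : ℕ}
    (hJ : stalkIdeal J (π x') ≤ maximalIdeal (X.presheaf.stalk (π x')) ^ μ)
    (hJ' : ¬ stalkIdeal J (π x') ≤ maximalIdeal (X.presheaf.stalk (π x')) ^ (μ + 1)) :
    ¬ stalkIdeal (controlledTransform π C J μ) x' ≤
      maximalIdeal (X'.presheaf.stalk x') ^ (μ + 1) := by
  intro hle
  -- an element `f ∈ J_x` of order exactly `μ`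
  obtain ⟨f, hfJ, hf'⟩ := Set.not_subset.mp hJ'
  have hf : f ∈ maximalIdeal (X.presheaf.stalk (π x')) ^ μ := hJ hfJ
  -- a regular system of parameters of `𝒪_{X,x}` and the chart presentation of `𝒪_{X′,x′}`
  obtain ⟨c, hc⟩ := exists_regularSystemOfParameters (R := X.presheaf.stalk (π x'))
  generalize hd : (maximalIdeal (X.presheaf.stalk (π x'))).spanFinrank = d at c hc
  obtain ⟨j, 𝔴, χ, hχ, hloc, h𝔴⟩ := hπ.exists_reesChart_stalk x' c (hc.trans hC.symm)
  have h𝔴j : chartBase c j (c j) ∈ 𝔴.asIdeal := by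
    rw [← Ideal.mem_comap, h𝔴, ← hc]
    exact Ideal.subset_span ⟨j, rfl⟩
  -- the weak transform `f′` of `f` on the chart, of order `≤ μ` at `𝔴`
  obtain ⟨f', hff', hford⟩ :=
    exists_weakTransform_chart_not_mem_pow hd c hc j hf hf' 𝔴.asIdeal h𝔴j
  -- `𝓘(E)_{x′} = (χ φ c_j)` and `χ f′ ∈ J′_{x′}`
  have hu : ∀ l, (π.stalkMap x').hom (c l) = (π.stalkMap x').hom (c j) * χ (chartGen c j l) :=
    fun l => by rw [← hχ, ← hχ, ← map_mul, ← reesChartBase_apply_eq_mul_chartGen c j l]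
  have hCmap : (stalkIdeal C (π x')).map (π.stalkMap x').hom =
      Ideal.span {χ (chartBase c j (c j))} := by
    rw [hC, ← hc, Ideal.map_span_range_eq_span_singleton _ c j _ hu, ← hχ]
  have hmem : χ f' ∈ stalkIdeal (controlledTransform π C J μ) x' := by
    rw [controlledTransform, stalkIdeal_colon, stalkIdeal_pow, stalkIdeal_comap_eq_map_stalkMap,
      stalkIdeal_comap_eq_map_stalkMap, hCmap]
    exact map_mem_colon_of_eq_pow_mul (chartBase c j) χ (π.stalkMap x').hom hχ hff' hfJ
  -- transport `ord_𝔴 f′ ≤ μ` from `(B_j)_𝔴` to `𝒪_{X′,x′}`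
  letI := χ.toAlgebra
  haveI : IsLocalization.AtPrime (X'.presheaf.stalk x') 𝔴.asIdeal := hloc
  exact algebraMap_not_mem_maximalIdeal_pow_of_isLocalization 𝔴.asIdeal hford (hle hmem)

/-- The same in terms of `idealOrder` (`MarkedIdeals.lean`): **if `ord_x J = μ` then
`ord_{x′} J′ ≤ μ` for every `x′` over `x`** ([CoP1] (a)). [cite: CossartPiltant2008, proof of Prop. 4.2 (a)] -/
theorem IsBlowup.idealOrder_controlledTransform_le [IsLocallyNoetherian X'] (hπ : IsBlowup π C)
    (x' : X') [IsRegularLocalRing (X.presheaf.stalk (π x'))]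
    (hC : stalkIdeal C (π x') = maximalIdeal (X.presheaf.stalk (π x'))) {μ : ℕ}
    (hJ : idealOrder J (π x') = μ) :
    idealOrder (controlledTransform π C J μ) x' ≤ μ := by
  have h1 : stalkIdeal J (π x') ≤ maximalIdeal _ ^ μ := (le_idealOrder_iff J (π x') μ).mp hJ.ge
  have h2 : ¬ stalkIdeal J (π x') ≤ maximalIdeal _ ^ (μ + 1) := by
    rw [← le_idealOrder_iff, hJ]
    exact_mod_cast Nat.not_succ_le_self μ
  have := hπ.not_stalkIdeal_controlledTransform_le_pow x' hC h1 h2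
  rw [← le_idealOrder_iff] at this
  by_contra h
  exact this (Order.add_one_le_of_lt (not_le.mp h))

end Literature.AlgebraicGeometry.Resolution

end
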